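import Literature.NumberTheory.LFunctions.GaussianHeckeMollifierMeanSquare
import Literature.NumberTheory.LFunctions.GaussianHeckeZeroDetect
import Literature.NumberTheory.LFunctions.ZeroDensityInghamTools
import Mathlib.Analysis.SpecialFunctions.ImproperIntegrals
import Mathlib.MeasureTheory.Group.Integral
import HarnessLib

/-!
# Class-II zeros of the family `L(s, λ^m)`, `m ≤ K`: the count from a pointwise bound on `Re s = 1/2`

Topic `Literature/NumberTheory/LFunctions`.  Everything in this file is PROVED; no definitions, no named
facts.  This is the "class II" half of Montgomery's zero-detection method (Montgomery 1971, Ch. 12;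
Ingham 1937/1940 for `ζ`) for the Hecke `L`-functions `D_m(s) = 4 L(s, λ^m)` of `ℚ(i)`, in the form fed
by `GaussianHecke.zero_detect`: a zero `ρ = β + iγ` of `D_m` is of class II when

  `1 ≤ 9600 · x^{1/2-β} ∫ |D_m(1/2 + i(γ+t))| |M_X(1/2 + i(γ+t); λ^m)| (1 + |t|)⁻⁴ dt`.

`GaussianHecke.exists_classTwo`: assume a pointwise bound on the critical line
`(PW θ,c)  |D_m(1/2 + iτ)| ≤ A₁ (m + |τ| + 2)^θ log^c (m + |τ| + 2)` (`m ≥ 1`, `0 ≤ θ < 1`).  Then for a finite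
family `Z` of pairs `(m, ρ)` with `1 ≤ m ≤ K`, `Re ρ ≥ σ`, `|Im ρ| < T`, ordinates `≥ 1` apart for each
fixed `m`, all of class II,

  `#Z ≤ C₂ (A₁ (1 + 2c/(1-θ))^c)² x^{1-2σ} (K+T+2)^{2θ} (1 + log(K+T+2))^{2c} (X + K) T (1 + log X)³`.

Proof: `(PW)` gives `|D_m(1/2+i(γ+t))| (1+|t|)⁻⁴ ≤ A₃ (1+|t|)⁻³` uniformly over the family
(`norm_heckeL_half_le_of_pointwise`, absorbing `log^c(1+|t|) ≤ (1 + 2c/(1-θ))^c (1+|t|)^{(1-θ)/2}`); the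
inequality `|M| ≤ (λ|M|² + λ⁻¹)/2` with `λ = π B`, `B = 9600 x^{1/2-σ} A₃`, turns each class-II condition
into `1 ≤ π B² ∫ |M_X(1/2+i(γ+t); λ^m)|² (1+|t|)⁻³ dt` (`classTwo_single`); summing over `Z`, the kernels
`∑_{γ ∈ Z_m} (1 + |τ-γ|)⁻³` are bounded by an integrable majorant `w_T` with `∫ w_T ≤ 76 T` (well-spacing,
`ZeroDensity.sum_inv_sq_add_sq_le`), and the mean square of the mollifier over the family
(`GaussianHecke.exists_sum_norm_sq_mollifier_le`) is `≤ C (X+K)(1 + log X)³` uniformly in `τ`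
(`sum_integral_le`).

## References

* H. L. Montgomery, *Topics in Multiplicative Number Theory*, LNM 227 (1971), Ch. 12. [Montgomery1971]
* A. E. Ingham, *On the estimation of `N(σ,T)`*, Quart. J. Math. 11 (1940) 291–292. [Ingham1940]
-/

noncomputable section

open Finset Complex MeasureTheory Real

namespace Literature.NumberTheory.LFunctions

namespace GaussianHecke

open GaussianInt GaussianTheta ZeroDensity

open scoped Classical

/-! ### Elementary inequalities -/

/-- `(1 + log u)^c ≤ (1 + c/δ)^c u^δ` for `u ≥ 1`, `δ > 0`. [folklore] -/
theorem one_add_log_pow_le {u δ : ℝ} (hu : 1 ≤ u) (hδ : 0 < δ) (c : ℕ) :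
    (1 + Real.log u) ^ c ≤ (1 + c / δ) ^ c * u ^ δ := by
  have hu0 : 0 ≤ u := by linarith
  have hlog0 : 0 ≤ Real.log u := Real.log_nonneg hu
  rcases Nat.eq_zero_or_pos c with rfl | hc
  · simp only [pow_zero, one_mul]
    exact Real.one_le_rpow hu hδ.le
  have hc0 : (0 : ℝ) < c := by exact_mod_cast hc
  have hε : 0 < δ / c := div_pos hδ hc0
  have h1 : Real.log u ≤ u ^ (δ / c) / (δ / c) := Real.log_le_rpow_div hu0 hε
  have h2 : 1 ≤ u ^ (δ / c) := Real.one_le_rpow hu hε.le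
  have h1' : Real.log u ≤ c / δ * u ^ (δ / c) := by
    rw [div_div_eq_mul_div] at h1
    calc Real.log u ≤ u ^ (δ / c) * c / δ := h1
      _ = c / δ * u ^ (δ / c) := by ring
  have h3 : 1 + Real.log u ≤ (1 + c / δ) * u ^ (δ / c) := by
    have : (1 + c / δ) * u ^ (δ / c) = u ^ (δ / c) + c / δ * u ^ (δ / c) := by ring
    rw [this]; linarith
  calc (1 + Real.log u) ^ c ≤ ((1 + c / δ) * u ^ (δ / c)) ^ c := pow_le_pow_left₀ (by linarith) h3 c
    _ = (1 + c / δ) ^ c * u ^ δ := by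
        rw [mul_pow, ← Real.rpow_natCast (u ^ (δ / c)) c, ← Real.rpow_mul hu0, div_mul_cancel₀ δ hc0.ne']

/-- `(1 + |u|)³ ≥ 1 + u²`. [folklore] -/
theorem inv_cube_le_inv_one_add_sq (u : ℝ) : ((1 + |u|) ^ 3)⁻¹ ≤ (1 + u ^ 2)⁻¹ := by
  have hu := abs_nonneg u
  have h1 : 1 + u ^ 2 ≤ (1 + |u|) ^ 3 := by
    rw [← sq_abs u]
    nlinarith [pow_nonneg hu 3, sq_nonneg |u|]
  exact inv_anti₀ (by positivity) h1

/-- For `|γ| < T` and `τ > 2T`: `(1 + |τ - γ|)⁻³ ≤ (1 + (τ - 2T)²)⁻¹`. [folklore] -/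
theorem inv_cube_le_right {γ τ T : ℝ} (hγ : |γ| < T) (hτ : 2 * T < τ) :
    ((1 + |τ - γ|) ^ 3)⁻¹ ≤ (1 + (τ - 2 * T) ^ 2)⁻¹ := by
  rw [abs_lt] at hγ
  have h0 : 0 ≤ τ - 2 * T := by linarith
  have hb : 0 ≤ |τ - γ| := abs_nonneg _
  have h1 : τ - 2 * T ≤ |τ - γ| := by rw [abs_of_nonneg (by linarith)]; linarith
  have h2 : 1 + (τ - 2 * T) ^ 2 ≤ (1 + |τ - γ|) ^ 3 := by
    nlinarith [mul_nonneg (sub_nonneg.2 h1) (add_nonneg h0 hb), pow_nonneg hb 3, sq_nonneg |τ - γ|]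
  exact inv_anti₀ (by positivity) h2

/-- For `|γ| < T` and `τ < -2T`: `(1 + |τ - γ|)⁻³ ≤ (1 + (τ + 2T)²)⁻¹`. [folklore] -/
theorem inv_cube_le_left {γ τ T : ℝ} (hγ : |γ| < T) (hτ : τ < -(2 * T)) :
    ((1 + |τ - γ|) ^ 3)⁻¹ ≤ (1 + (τ + 2 * T) ^ 2)⁻¹ := by
  rw [abs_lt] at hγ
  have h0 : 0 ≤ -(τ + 2 * T) := by linarith
  have hb : 0 ≤ |τ - γ| := abs_nonneg _
  have h1 : -(τ + 2 * T) ≤ |τ - γ| := by rw [abs_of_nonpos (by linarith)]; linarith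
  have h2 : 1 + (τ + 2 * T) ^ 2 ≤ (1 + |τ - γ|) ^ 3 := by
    have e : (τ + 2 * T) ^ 2 = (-(τ + 2 * T)) ^ 2 := by ring
    rw [e]
    nlinarith [mul_nonneg (sub_nonneg.2 h1) (add_nonneg h0 hb), pow_nonneg hb 3, sq_nonneg |τ - γ|]
  exact inv_anti₀ (by positivity) h2

/-- A finite set of reals in `(-T, T)` pairwise `≥ 1` apart has at most `2T + 4` elements. [folklore] -/
theorem card_le_of_sep (𝒯 : Finset ℝ) {T : ℝ} (hT : 0 ≤ T) (hmem : ∀ t ∈ 𝒯, |t| < T)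
    (hsep : ∀ t ∈ 𝒯, ∀ t' ∈ 𝒯, t ≠ t' → 1 ≤ |t - t'|) : (𝒯.card : ℝ) ≤ 2 * T + 4 := by
  have hinj := injOn_floor_of_sep 𝒯 hsep
  have hmaps : Set.MapsTo (fun t : ℝ ↦ ⌊t⌋) ↑𝒯 ↑(Finset.Icc (-⌈T⌉ - 1) ⌈T⌉) := by
    intro t ht
    have h := hmem t (Finset.mem_coe.1 ht)
    rw [abs_lt] at h
    rw [Finset.coe_Icc, Set.mem_Icc]
    constructor
    · have h1 : (-T - 1 : ℝ) < ⌊t⌋ := by have := Int.lt_floor_add_one t; linarith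
      have h2 : ((-⌈T⌉ - 1 : ℤ) : ℝ) ≤ -T - 1 := by push_cast; linarith [Int.le_ceil T]
      exact_mod_cast (h2.trans_lt h1).le
    · have h1 : ((⌊t⌋ : ℤ) : ℝ) < ⌈T⌉ := (Int.floor_le t).trans_lt (h.2.trans_le (Int.le_ceil T))
      exact_mod_cast h1.le
  have hcard := Finset.card_le_card_of_injOn _ hmaps hinj
  have h0 : 0 ≤ ⌈T⌉ := Int.ceil_nonneg hT
  have h1 : (⌈T⌉ : ℝ) < T + 1 := Int.ceil_lt_add_one T
  have hc : ((Finset.Icc (-⌈T⌉ - 1) ⌈T⌉).card : ℝ) = 2 * ⌈T⌉ + 2 := by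
    rw [Int.card_Icc, show ⌈T⌉ + 1 - (-⌈T⌉ - 1) = 2 * ⌈T⌉ + 2 by ring]
    have h2 : (0 : ℤ) ≤ 2 * ⌈T⌉ + 2 := by omega
    have h3 : (((2 * ⌈T⌉ + 2).toNat : ℤ) : ℝ) = ((2 * ⌈T⌉ + 2 : ℤ) : ℝ) := by rw [Int.toNat_of_nonneg h2]
    have h4 : (((2 * ⌈T⌉ + 2).toNat : ℕ) : ℝ) = (((2 * ⌈T⌉ + 2).toNat : ℤ) : ℝ) := by norm_cast
    rw [h4, h3]; push_cast; ring
  have : (𝒯.card : ℝ) ≤ ((Finset.Icc (-⌈T⌉ - 1) ⌈T⌉).card : ℝ) := by exact_mod_cast hcard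
  linarith

/-- **Kernel sums over the ordinates of one `m`.**  For a finite set `𝒯 ⊆ (-T, T)` of reals pairwise
`≥ 1` apart and every real `τ`,
`∑_{t ∈ 𝒯} (1 + |τ - t|)⁻³ ≤ w_T(τ) := 7·𝟙_{[-2T,2T]}(τ) + (2T+4)((1+(τ-2T)²)⁻¹ + (1+(τ+2T)²)⁻¹)`.
[folklore] -/
theorem sum_inv_cube_le (𝒯 : Finset ℝ) {T : ℝ} (hT : 0 ≤ T) (hmem : ∀ t ∈ 𝒯, |t| < T)
    (hsep : ∀ t ∈ 𝒯, ∀ t' ∈ 𝒯, t ≠ t' → 1 ≤ |t - t'|) (τ : ℝ) :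
    ∑ t ∈ 𝒯, ((1 + |τ - t|) ^ 3)⁻¹ ≤
      Set.indicator (Set.Icc (-(2 * T)) (2 * T)) (fun _ ↦ (7 : ℝ)) τ +
        (2 * T + 4) * ((1 + (τ - 2 * T) ^ 2)⁻¹ + (1 + (τ + 2 * T) ^ 2)⁻¹) := by
  have hA0 : 0 ≤ (1 + (τ - 2 * T) ^ 2)⁻¹ := by positivity
  have hB0 : 0 ≤ (1 + (τ + 2 * T) ^ 2)⁻¹ := by positivity
  have hT4 : 0 ≤ 2 * T + 4 := by linarith
  by_cases hτ : τ ∈ Set.Icc (-(2 * T)) (2 * T)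
  · rw [Set.indicator_of_mem hτ]
    have h7 : ∑ t ∈ 𝒯, ((1 + |τ - t|) ^ 3)⁻¹ ≤ 7 := by
      calc ∑ t ∈ 𝒯, ((1 + |τ - t|) ^ 3)⁻¹ ≤ ∑ t ∈ 𝒯, ((1 : ℝ) ^ 2 + (τ - t) ^ 2)⁻¹ :=
            sum_le_sum fun t _ ↦ by rw [one_pow]; exact inv_cube_le_inv_one_add_sq (τ - t)
        _ ≤ 3 * ((1 : ℝ) ^ 2)⁻¹ + 4 := sum_inv_sq_add_sq_le 𝒯 hsep one_pos τ
        _ = 7 := by norm_num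
    nlinarith [mul_nonneg hT4 (add_nonneg hA0 hB0)]
  · rw [Set.indicator_of_notMem hτ, zero_add]
    rw [Set.mem_Icc, not_and_or, not_le, not_le] at hτ
    have hcard := card_le_of_sep 𝒯 hT hmem hsep
    rcases hτ with hτ | hτ
    · calc ∑ t ∈ 𝒯, ((1 + |τ - t|) ^ 3)⁻¹ ≤ ∑ t ∈ 𝒯, (1 + (τ + 2 * T) ^ 2)⁻¹ :=
            sum_le_sum fun t ht ↦ inv_cube_le_left (hmem t ht) hτ
        _ = 𝒯.card * (1 + (τ + 2 * T) ^ 2)⁻¹ := by rw [sum_const, nsmul_eq_mul]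
        _ ≤ (2 * T + 4) * (1 + (τ + 2 * T) ^ 2)⁻¹ := mul_le_mul_of_nonneg_right hcard hB0
        _ ≤ _ := by nlinarith [mul_nonneg hT4 hA0]
    · calc ∑ t ∈ 𝒯, ((1 + |τ - t|) ^ 3)⁻¹ ≤ ∑ t ∈ 𝒯, (1 + (τ - 2 * T) ^ 2)⁻¹ :=
            sum_le_sum fun t ht ↦ inv_cube_le_right (hmem t ht) hτ
        _ = 𝒯.card * (1 + (τ - 2 * T) ^ 2)⁻¹ := by rw [sum_const, nsmul_eq_mul]
        _ ≤ (2 * T + 4) * (1 + (τ - 2 * T) ^ 2)⁻¹ := mul_le_mul_of_nonneg_right hcard hA0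
        _ ≤ _ := by nlinarith [mul_nonneg hT4 hB0]

/-- The majorant `w_T` is integrable. [folklore] -/
theorem integrable_majorant (T : ℝ) :
    Integrable (fun τ : ℝ ↦ Set.indicator (Set.Icc (-(2 * T)) (2 * T)) (fun _ ↦ (7 : ℝ)) τ +
        (2 * T + 4) * ((1 + (τ - 2 * T) ^ 2)⁻¹ + (1 + (τ + 2 * T) ^ 2)⁻¹)) := by
  refine Integrable.add ?_ (Integrable.const_mul (Integrable.add ?_ ?_) _)
  · exact (integrable_indicator_iff measurableSet_Icc).2
      (integrableOn_const (hs := by rw [Real.volume_Icc]; exact ENNReal.ofReal_ne_top))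
  · exact integrable_inv_one_add_sq.comp_sub_right (2 * T)
  · have h := integrable_inv_one_add_sq.comp_sub_right (-(2 * T))
    simpa only [sub_neg_eq_add] using h

/-- `∫ w_T ≤ 76 T` for `T ≥ 1`. [folklore] -/
theorem integral_majorant_le {T : ℝ} (hT : 1 ≤ T) :
    ∫ τ : ℝ, (Set.indicator (Set.Icc (-(2 * T)) (2 * T)) (fun _ ↦ (7 : ℝ)) τ +
        (2 * T + 4) * ((1 + (τ - 2 * T) ^ 2)⁻¹ + (1 + (τ + 2 * T) ^ 2)⁻¹)) ≤ 76 * T := by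
  have h1 : Integrable (fun τ : ℝ ↦ Set.indicator (Set.Icc (-(2 * T)) (2 * T)) (fun _ ↦ (7 : ℝ)) τ) :=
    (integrable_indicator_iff measurableSet_Icc).2
      (integrableOn_const (hs := by rw [Real.volume_Icc]; exact ENNReal.ofReal_ne_top))
  have h2 : Integrable (fun τ : ℝ ↦ (1 + (τ - 2 * T) ^ 2)⁻¹) :=
    integrable_inv_one_add_sq.comp_sub_right (2 * T)
  have h3 : Integrable (fun τ : ℝ ↦ (1 + (τ + 2 * T) ^ 2)⁻¹) := by
    have h := integrable_inv_one_add_sq.comp_sub_right (-(2 * T))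
    simpa only [sub_neg_eq_add] using h
  have e2 : ∫ τ : ℝ, (1 + (τ - 2 * T) ^ 2)⁻¹ = Real.pi := by
    rw [← integral_univ_inv_one_add_sq]
    exact integral_sub_right_eq_self (fun u : ℝ ↦ (1 + u ^ 2)⁻¹) (2 * T)
  have e3 : ∫ τ : ℝ, (1 + (τ + 2 * T) ^ 2)⁻¹ = Real.pi := by
    rw [← integral_univ_inv_one_add_sq]
    exact integral_add_right_eq_self (fun u : ℝ ↦ (1 + u ^ 2)⁻¹) (2 * T)
  have h23 : Integrable (fun τ : ℝ ↦ (2 * T + 4) * ((1 + (τ - 2 * T) ^ 2)⁻¹ + (1 + (τ + 2 * T) ^ 2)⁻¹)) :=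
    (h2.add h3).const_mul _
  rw [integral_add h1 h23, integral_const_mul, integral_add h2 h3,
    integral_indicator_const _ measurableSet_Icc, volume_real_Icc_of_le (by linarith), e2, e3, smul_eq_mul]
  have hπ : Real.pi ≤ 4 := Real.pi_le_four
  nlinarith [Real.pi_pos]

/-! ### The pointwise bound on the critical line -/

/-- From `(PW θ,c)`: for `1 ≤ m ≤ K`, `|γ| < T` and every real `t`,
`|D_m(1/2 + i(γ+t))| ≤ A₁ (1 + c/δ)^c (K+T+2)^θ (1 + log(K+T+2))^c (1 + |t|)`, `δ = (1-θ)/2`. [folklore] -/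
theorem norm_heckeL_half_le_of_pointwise {A₁ θ : ℝ} {c : ℕ} (hA : 0 ≤ A₁) (hθ : 0 ≤ θ) (hθ1 : θ < 1)
    (hPW : ∀ m : ℕ, m ≠ 0 → ∀ τ : ℝ, ‖heckeL m (1 / 2 + τ * I)‖ ≤
        A₁ * ((m : ℝ) + |τ| + 2) ^ θ * Real.log ((m : ℝ) + |τ| + 2) ^ c)
    {m K : ℕ} (hm : m ≠ 0) (hmK : m ≤ K) {γ T : ℝ} (hγ : |γ| < T) (t : ℝ) :
    ‖heckeL m (1 / 2 + (γ + t) * I)‖ ≤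
      A₁ * (1 + c / ((1 - θ) / 2)) ^ c * ((K : ℝ) + T + 2) ^ θ *
        (1 + Real.log ((K : ℝ) + T + 2)) ^ c * (1 + |t|) := by
  set δ : ℝ := (1 - θ) / 2 with hδ
  have hδ0 : 0 < δ := by rw [hδ]; linarith
  set K' : ℝ := (K : ℝ) + T + 2 with hK'
  have hT0 : 0 < T := (abs_nonneg γ).trans_lt hγ
  have hK0 : (0 : ℝ) ≤ K := Nat.cast_nonneg K
  have hK'1 : 1 ≤ K' := by rw [hK']; linarith
  have ht0 : 0 ≤ |t| := abs_nonneg t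
  set u₀ : ℝ := (m : ℝ) + |γ + t| + 2 with hu₀
  have hm0 : (0 : ℝ) ≤ m := Nat.cast_nonneg m
  have hu₀1 : 1 ≤ u₀ := by rw [hu₀]; linarith [abs_nonneg (γ + t)]
  have hu₀le : u₀ ≤ K' * (1 + |t|) := by
    have h1 : |γ + t| ≤ |γ| + |t| := abs_add_le γ t
    have h2 : (m : ℝ) ≤ K := by exact_mod_cast hmK
    rw [hu₀, hK']
    nlinarith
  have h := hPW m hm (γ + t)
  rw [Complex.ofReal_add] at h
  have hpow : u₀ ^ θ ≤ K' ^ θ * (1 + |t|) ^ θ := by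
    rw [← Real.mul_rpow (by linarith) (by linarith)]
    exact Real.rpow_le_rpow (by linarith) hu₀le hθ
  have hlogK : 0 ≤ Real.log K' := Real.log_nonneg hK'1
  have hlogu : Real.log u₀ ≤ (1 + Real.log K') * (1 + Real.log (1 + |t|)) := by
    have h1 : Real.log u₀ ≤ Real.log (K' * (1 + |t|)) := Real.log_le_log (by linarith) hu₀le
    rw [Real.log_mul (by linarith) (by linarith)] at h1
    have h3 : 0 ≤ Real.log (1 + |t|) := Real.log_nonneg (by linarith)
    nlinarith
  have hlogc : Real.log u₀ ^ c ≤ (1 + Real.log K') ^ c * ((1 + c / δ) ^ c * (1 + |t|) ^ δ) := by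
    calc Real.log u₀ ^ c ≤ ((1 + Real.log K') * (1 + Real.log (1 + |t|))) ^ c :=
          pow_le_pow_left₀ (Real.log_nonneg hu₀1) hlogu c
      _ = (1 + Real.log K') ^ c * (1 + Real.log (1 + |t|)) ^ c := mul_pow _ _ _
      _ ≤ (1 + Real.log K') ^ c * ((1 + c / δ) ^ c * (1 + |t|) ^ δ) :=
          mul_le_mul_of_nonneg_left (one_add_log_pow_le (by linarith) hδ0 c) (pow_nonneg (by linarith) c)
  have hexp : (1 + |t|) ^ θ * (1 + |t|) ^ δ ≤ 1 + |t| := by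
    rw [← Real.rpow_add (by linarith)]
    calc (1 + |t|) ^ (θ + δ) ≤ (1 + |t|) ^ (1 : ℝ) :=
          Real.rpow_le_rpow_of_exponent_le (by linarith) (by rw [hδ]; linarith)
      _ = 1 + |t| := Real.rpow_one _
  have hu₀θ : 0 ≤ u₀ ^ θ := Real.rpow_nonneg (by linarith) θ
  have hpre : 0 ≤ A₁ * (1 + c / δ) ^ c * K' ^ θ * (1 + Real.log K') ^ c := by positivity
  calc ‖heckeL m (1 / 2 + (γ + t) * I)‖ ≤ A₁ * u₀ ^ θ * Real.log u₀ ^ c := h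
    _ ≤ A₁ * (K' ^ θ * (1 + |t|) ^ θ) * ((1 + Real.log K') ^ c * ((1 + c / δ) ^ c * (1 + |t|) ^ δ)) :=
        mul_le_mul (mul_le_mul_of_nonneg_left hpow hA) hlogc (pow_nonneg (Real.log_nonneg hu₀1) c)
          (by positivity)
    _ = A₁ * (1 + c / δ) ^ c * K' ^ θ * (1 + Real.log K') ^ c * ((1 + |t|) ^ θ * (1 + |t|) ^ δ) := by
        ring
    _ ≤ A₁ * (1 + c / δ) ^ c * K' ^ θ * (1 + Real.log K') ^ c * (1 + |t|) :=
        mul_le_mul_of_nonneg_left hexp hpre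

/-! ### One class-II zero -/

/-- **One class-II zero.**  If `|D_m(1/2+i(γ+t))| ≤ A₃ (1 + |t|)` for all `t` and the class-II
inequality holds with the factor `B₀ > 0`, then `1 ≤ π (B₀ A₃)² ∫ |M_X(1/2+i(γ+t); λ^m)|² (1+|t|)⁻³ dt`.
[cite: Montgomery1971, Ch. 12] -/
theorem classTwo_single {m : ℕ} (X : ℝ) {A₃ B₀ : ℝ} (hA₃ : 0 < A₃) (hB₀ : 0 < B₀) (γ : ℝ)
    (hD : ∀ t : ℝ, ‖heckeL m (1 / 2 + (γ + t) * I)‖ ≤ A₃ * (1 + |t|))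
    (hII : 1 ≤ B₀ * ∫ t : ℝ, ‖heckeL m (1 / 2 + (γ + t) * I)‖ *
        ‖LSeries (moebCoeff m X) (1 / 2 + (γ + t) * I)‖ * ((1 + |t|) ^ 4)⁻¹) :
    1 ≤ Real.pi * (B₀ * A₃) ^ 2 *
      ∫ t : ℝ, ‖LSeries (moebCoeff m X) (1 / 2 + (γ + t) * I)‖ ^ 2 * ((1 + |t|) ^ 3)⁻¹ := by
  set Mf : ℝ → ℝ := fun t ↦ ‖LSeries (moebCoeff m X) (1 / 2 + (γ + t) * I)‖ with hMf
  set w₃ : ℝ → ℝ := fun t ↦ ((1 + |t|) ^ 3)⁻¹ with hw₃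
  set J : ℝ := ∫ t : ℝ, Mf t ^ 2 * w₃ t with hJ
  have hline : Continuous fun t : ℝ ↦ (1 / 2 : ℂ) + (γ + t) * I := by fun_prop
  have hMc : Continuous Mf := ((differentiable_LSeries_moebCoeff m X).continuous.comp hline).norm
  have hw₃c : Continuous w₃ := by
    refine Continuous.inv₀ (by fun_prop) fun t ↦ ?_
    positivity
  have hw₃0 : ∀ t, 0 ≤ w₃ t := fun t ↦ by positivity
  have hw₃le : ∀ t, w₃ t ≤ (1 + t ^ 2)⁻¹ := fun t ↦ inv_cube_le_inv_one_add_sq t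
  have hM0 : ∀ t, 0 ≤ Mf t := fun t ↦ norm_nonneg _
  set N₀ : ℝ := ((normLEStar X).card : ℝ) with hN₀
  have hN0 : 0 ≤ N₀ := Nat.cast_nonneg _
  have hMle : ∀ t, Mf t ≤ N₀ := fun t ↦ norm_LSeries_moebCoeff_le m X (by simp)
  have hw₃i : Integrable w₃ := by
    refine Integrable.mono' integrable_inv_one_add_sq hw₃c.aestronglyMeasurable
      (Filter.Eventually.of_forall fun t ↦ ?_)
    rw [Real.norm_of_nonneg (hw₃0 t)]
    exact hw₃le t
  have hint1 : Integrable (fun t ↦ Mf t * w₃ t) := by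
    refine Integrable.mono' (integrable_inv_one_add_sq.const_mul N₀) (hMc.mul hw₃c).aestronglyMeasurable
      (Filter.Eventually.of_forall fun t ↦ ?_)
    rw [Real.norm_of_nonneg (mul_nonneg (hM0 t) (hw₃0 t))]
    exact mul_le_mul (hMle t) (hw₃le t) (hw₃0 t) hN0
  have hint2 : Integrable (fun t ↦ Mf t ^ 2 * w₃ t) := by
    refine Integrable.mono' (integrable_inv_one_add_sq.const_mul (N₀ ^ 2)) ((hMc.pow 2).mul hw₃c).aestronglyMeasurable
      (Filter.Eventually.of_forall fun t ↦ ?_)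
    rw [Real.norm_of_nonneg (mul_nonneg (pow_nonneg (hM0 t) 2) (hw₃0 t))]
    exact mul_le_mul (pow_le_pow_left₀ (hM0 t) (hMle t) 2) (hw₃le t) (hw₃0 t) (by positivity)
  have hJ0 : 0 ≤ J := integral_nonneg fun t ↦ mul_nonneg (pow_nonneg (hM0 t) 2) (hw₃0 t)
  -- Step 1: `∫ |D| |M| (1+|t|)⁻⁴ ≤ A₃ ∫ |M| (1+|t|)⁻³`
  have hstep1 : ∫ t : ℝ, ‖heckeL m (1 / 2 + (γ + t) * I)‖ * Mf t * ((1 + |t|) ^ 4)⁻¹ ≤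
      A₃ * ∫ t, Mf t * w₃ t := by
    rw [← integral_const_mul]
    refine integral_mono_of_nonneg (Filter.Eventually.of_forall fun t ↦ ?_) (hint1.const_mul A₃)
      (Filter.Eventually.of_forall fun t ↦ ?_)
    · exact mul_nonneg (mul_nonneg (norm_nonneg _) (hM0 t)) (by positivity)
    · have ht1 : 0 < 1 + |t| := by positivity
      have e : A₃ * (Mf t * w₃ t) = A₃ * (1 + |t|) * Mf t * ((1 + |t|) ^ 4)⁻¹ := by
        simp only [hw₃]; field_simp
      show ‖heckeL m (1 / 2 + (γ + t) * I)‖ * Mf t * ((1 + |t|) ^ 4)⁻¹ ≤ A₃ * (Mf t * w₃ t)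
      rw [e]
      exact mul_le_mul_of_nonneg_right (mul_le_mul_of_nonneg_right (hD t) (hM0 t)) (by positivity)
  -- `∫ (1+|t|)⁻³ ≤ π`
  have hw₃int : ∫ t, w₃ t ≤ Real.pi := by
    rw [← integral_univ_inv_one_add_sq]
    exact integral_mono_of_nonneg (Filter.Eventually.of_forall hw₃0) integrable_inv_one_add_sq
      (Filter.Eventually.of_forall hw₃le)
  -- Step 2: `|M| ≤ (λ|M|² + λ⁻¹)/2` with `λ = π B₀ A₃`
  set lam : ℝ := Real.pi * (B₀ * A₃) with hlam
  have hlam0 : 0 < lam := by positivity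
  have hamgm : ∫ t, Mf t * w₃ t ≤ (lam * J + lam⁻¹ * Real.pi) / 2 := by
    have h1 : ∫ t, Mf t * w₃ t ≤ ∫ t, (lam * (Mf t ^ 2 * w₃ t) + lam⁻¹ * w₃ t) / 2 := by
      refine integral_mono_of_nonneg (Filter.Eventually.of_forall fun t ↦ mul_nonneg (hM0 t) (hw₃0 t))
        (((hint2.const_mul lam).add (hw₃i.const_mul lam⁻¹)).div_const 2)
        (Filter.Eventually.of_forall fun t ↦ ?_)
      have hsq : 0 ≤ lam * (Mf t - lam⁻¹) ^ 2 * w₃ t := by positivity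
      have e : (lam * (Mf t ^ 2 * w₃ t) + lam⁻¹ * w₃ t) / 2 - Mf t * w₃ t =
          lam * (Mf t - lam⁻¹) ^ 2 * w₃ t / 2 := by
        field_simp
        ring
      show Mf t * w₃ t ≤ (lam * (Mf t ^ 2 * w₃ t) + lam⁻¹ * w₃ t) / 2
      linarith
    have h2 : ∫ t, (lam * (Mf t ^ 2 * w₃ t) + lam⁻¹ * w₃ t) / 2 = (lam * J + lam⁻¹ * ∫ t, w₃ t) / 2 := by
      rw [integral_div, integral_add (hint2.const_mul lam) (hw₃i.const_mul lam⁻¹), integral_const_mul,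
        integral_const_mul]
    rw [h2] at h1
    have h3 : lam⁻¹ * ∫ t, w₃ t ≤ lam⁻¹ * Real.pi := mul_le_mul_of_nonneg_left hw₃int (inv_nonneg.2 hlam0.le)
    linarith
  -- conclusion
  have h4 : 1 ≤ B₀ * (A₃ * ∫ t, Mf t * w₃ t) := hII.trans (mul_le_mul_of_nonneg_left hstep1 hB₀.le)
  have h5 : B₀ * (A₃ * ∫ t, Mf t * w₃ t) ≤ B₀ * A₃ * ((lam * J + lam⁻¹ * Real.pi) / 2) := by
    rw [← mul_assoc]; exact mul_le_mul_of_nonneg_left hamgm (by positivity)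
  have e : B₀ * A₃ * ((lam * J + lam⁻¹ * Real.pi) / 2) = (Real.pi * (B₀ * A₃) ^ 2 * J + 1) / 2 := by
    rw [hlam]
    field_simp
  linarith

/-! ### Summing the class-II integrals over the family -/

/-- **The class-II integrals summed over a well-spaced family.**  With the absolute `C` of
`GaussianHecke.exists_sum_norm_sq_mollifier_le`: for `X, T ≥ 1`, `K ≥ 1` and a finite family `Z` of pairs
`(m, ρ)` with `1 ≤ m ≤ K`, `|Im ρ| < T`, ordinates `≥ 1` apart for each fixed `m`,
`∑_{(m,ρ) ∈ Z} ∫ |M_X(1/2 + i(Im ρ + t); λ^m)|² (1+|t|)⁻³ dt ≤ 76 C (X + K) T (1 + log X)³`.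
[cite: Montgomery1971, Ch. 12] -/
theorem sum_integral_le (hMVT : JarviniemiTeravainen2024_heckeMVT) :
    ∃ C : ℝ, 0 ≤ C ∧ ∀ (X T : ℝ) (K : ℕ) (Z : Finset (ℕ × ℂ)), 1 ≤ X → 1 ≤ T → 1 ≤ K →
      (∀ p ∈ Z, 1 ≤ p.1 ∧ p.1 ≤ K) → (∀ p ∈ Z, |p.2.im| < T) →
      (∀ p ∈ Z, ∀ p' ∈ Z, p.1 = p'.1 → p ≠ p' → 1 ≤ |p.2.im - p'.2.im|) →
      ∑ p ∈ Z, ∫ t : ℝ, ‖LSeries (moebCoeff p.1 X) (1 / 2 + (p.2.im + t) * I)‖ ^ 2 * ((1 + |t|) ^ 3)⁻¹ ≤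
        C * (X + K) * T * (1 + Real.log X) ^ 3 := by
  obtain ⟨C, hC, hMS⟩ := exists_sum_norm_sq_mollifier_le hMVT
  refine ⟨76 * C, by positivity, fun X T K Z hX hT hK hZ1 hZT hsep ↦ ?_⟩
  set Mτ : ℕ → ℝ → ℝ := fun m τ ↦ ‖LSeries (moebCoeff m X) (1 / 2 + τ * I)‖ with hMτ
  set w : ℝ → ℝ := fun τ ↦ Set.indicator (Set.Icc (-(2 * T)) (2 * T)) (fun _ ↦ (7 : ℝ)) τ +
      (2 * T + 4) * ((1 + (τ - 2 * T) ^ 2)⁻¹ + (1 + (τ + 2 * T) ^ 2)⁻¹) with hw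
  set F : ℕ × ℂ → ℝ → ℝ := fun p τ ↦ Mτ p.1 τ ^ 2 * ((1 + |τ - p.2.im|) ^ 3)⁻¹ with hF
  have hT0 : 0 ≤ T := by linarith
  -- (a) change of variables `τ = γ + t`
  have hcv : ∀ p ∈ Z, ∫ t : ℝ, ‖LSeries (moebCoeff p.1 X) (1 / 2 + (p.2.im + t) * I)‖ ^ 2 *
      ((1 + |t|) ^ 3)⁻¹ = ∫ τ, F p τ := by
    intro p _
    rw [← integral_add_right_eq_self (F p) p.2.im]
    refine integral_congr_ae (Filter.Eventually.of_forall fun t ↦ ?_)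
    simp only [hF, hMτ, add_sub_cancel_right, Complex.ofReal_add, add_comm (t : ℂ)]
  -- (b) integrability of `F p`
  have hN : ∀ m τ, Mτ m τ ≤ (normLEStar X).card := fun m τ ↦ norm_LSeries_moebCoeff_le m X (by simp)
  have hMc : ∀ m, Continuous (Mτ m) := fun m ↦
    ((differentiable_LSeries_moebCoeff m X).continuous.comp
      (by fun_prop : Continuous fun τ : ℝ ↦ (1 / 2 : ℂ) + τ * I)).norm
  have hF0 : ∀ p τ, 0 ≤ F p τ := fun p τ ↦ by simp only [hF]; positivity
  have hFint : ∀ p ∈ Z, Integrable (F p) := by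
    intro p _
    have hc : Continuous (F p) := by
      refine ((hMc p.1).pow 2).mul (Continuous.inv₀ (by fun_prop) fun τ ↦ ?_)
      positivity
    refine Integrable.mono' ((integrable_inv_one_add_sq.comp_sub_right p.2.im).const_mul
      (((normLEStar X).card : ℝ) ^ 2)) hc.aestronglyMeasurable (Filter.Eventually.of_forall fun τ ↦ ?_)
    rw [Real.norm_of_nonneg (hF0 p τ)]
    simp only [hF]
    exact mul_le_mul (pow_le_pow_left₀ (norm_nonneg _) (hN p.1 τ) 2) (inv_cube_le_inv_one_add_sq _)
      (by positivity) (by positivity)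
  -- (c) the pointwise bound `∑_p F p τ ≤ C (X+K) L³ w τ`
  have hw0 : ∀ τ, 0 ≤ w τ := fun τ ↦ by
    simp only [hw]
    refine add_nonneg (Set.indicator_nonneg (fun _ _ ↦ by norm_num) τ) (by positivity)
  have hker : ∀ τ m, ∑ p ∈ Z.filter (fun p ↦ p.1 = m), ((1 + |τ - p.2.im|) ^ 3)⁻¹ ≤ w τ := by
    intro τ m
    have hinj : Set.InjOn (fun p : ℕ × ℂ ↦ p.2.im) ↑(Z.filter (fun p ↦ p.1 = m)) := by
      intro p hp p' hp' h
      by_contra hne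
      rw [Finset.mem_coe, mem_filter] at hp hp'
      have h1 := hsep p hp.1 p' hp'.1 (hp.2.trans hp'.2.symm) hne
      simp only at h
      rw [h, sub_self, abs_zero] at h1
      linarith
    rw [← sum_image (f := fun γ : ℝ ↦ ((1 + |τ - γ|) ^ 3)⁻¹) hinj]
    refine sum_inv_cube_le _ hT0 (fun t ht ↦ ?_) (fun t ht t' ht' hne ↦ ?_) τ
    · rw [mem_image] at ht
      obtain ⟨p, hp, rfl⟩ := ht
      exact hZT p (mem_filter.1 hp).1
    · rw [mem_image] at ht ht'
      obtain ⟨p, hp, rfl⟩ := ht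
      obtain ⟨p', hp', rfl⟩ := ht'
      rw [mem_filter] at hp hp'
      exact hsep p hp.1 p' hp'.1 (hp.2.trans hp'.2.symm) (fun h ↦ hne (by rw [h]))
  have hpt : ∀ τ, ∑ p ∈ Z, F p τ ≤ C * (X + K) * (1 + Real.log X) ^ 3 * w τ := by
    intro τ
    have hmaps : ∀ p ∈ Z, p.1 ∈ Icc 1 K := fun p hp ↦ mem_Icc.2 (hZ1 p hp)
    rw [← sum_fiberwise_of_maps_to hmaps]
    have hfib : ∀ m ∈ Icc 1 K, ∑ p ∈ Z.filter (fun p ↦ p.1 = m), F p τ ≤ Mτ m τ ^ 2 * w τ := by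
      intro m _
      calc ∑ p ∈ Z.filter (fun p ↦ p.1 = m), F p τ
          = ∑ p ∈ Z.filter (fun p ↦ p.1 = m), Mτ m τ ^ 2 * ((1 + |τ - p.2.im|) ^ 3)⁻¹ := by
            refine sum_congr rfl fun p hp ↦ ?_
            have hpm : p.1 = m := (mem_filter.1 hp).2
            simp only [hF, hpm]
        _ = Mτ m τ ^ 2 * ∑ p ∈ Z.filter (fun p ↦ p.1 = m), ((1 + |τ - p.2.im|) ^ 3)⁻¹ := by
            rw [mul_sum]
        _ ≤ Mτ m τ ^ 2 * w τ := mul_le_mul_of_nonneg_left (hker τ m) (sq_nonneg _)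
    calc ∑ m ∈ Icc 1 K, ∑ p ∈ Z.filter (fun p ↦ p.1 = m), F p τ
        ≤ ∑ m ∈ Icc 1 K, Mτ m τ ^ 2 * w τ := sum_le_sum hfib
      _ = (∑ m ∈ Icc 1 K, Mτ m τ ^ 2) * w τ := by rw [sum_mul]
      _ ≤ C * (X + K) * (1 + Real.log X) ^ 3 * w τ := mul_le_mul_of_nonneg_right (hMS X K τ hX hK) (hw0 τ)
  -- (d) integrate
  have hL0 : 0 ≤ C * (X + K) * (1 + Real.log X) ^ 3 := by
    have : 0 ≤ Real.log X := Real.log_nonneg hX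
    have : (0 : ℝ) ≤ K := Nat.cast_nonneg K
    positivity
  calc ∑ p ∈ Z, ∫ t : ℝ, ‖LSeries (moebCoeff p.1 X) (1 / 2 + (p.2.im + t) * I)‖ ^ 2 * ((1 + |t|) ^ 3)⁻¹
      = ∑ p ∈ Z, ∫ τ, F p τ := sum_congr rfl hcv
    _ = ∫ τ, ∑ p ∈ Z, F p τ := (integral_finsetSum Z hFint).symm
    _ ≤ ∫ τ, C * (X + K) * (1 + Real.log X) ^ 3 * w τ :=
        integral_mono_of_nonneg (Filter.Eventually.of_forall fun τ ↦ sum_nonneg fun p _ ↦ hF0 p τ)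
          ((integrable_majorant T).const_mul _) (Filter.Eventually.of_forall hpt)
    _ = C * (X + K) * (1 + Real.log X) ^ 3 * ∫ τ, w τ := integral_const_mul _ _
    _ ≤ C * (X + K) * (1 + Real.log X) ^ 3 * (76 * T) :=
        mul_le_mul_of_nonneg_left (integral_majorant_le hT) hL0
    _ = 76 * C * (X + K) * T * (1 + Real.log X) ^ 3 := by ring

/-! ### The class-II count -/

/-- **Class-II zeros of the family from a pointwise bound on the critical line** (see the module
docstring).  [cite: Montgomery1971, Ch. 12, Thm 12.1 (method)] -/
theorem exists_classTwo (hMVT : JarviniemiTeravainen2024_heckeMVT) :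
    ∃ C₂ : ℝ, 0 ≤ C₂ ∧ ∀ (A₁ θ : ℝ) (c : ℕ), 1 ≤ A₁ → 0 ≤ θ → θ < 1 →
      (∀ m : ℕ, m ≠ 0 → ∀ τ : ℝ, ‖heckeL m (1 / 2 + τ * I)‖ ≤
          A₁ * ((m : ℝ) + |τ| + 2) ^ θ * Real.log ((m : ℝ) + |τ| + 2) ^ c) →
      ∀ (X x σ T : ℝ) (K : ℕ) (Z : Finset (ℕ × ℂ)), 1 ≤ X → 1 ≤ x → 1 ≤ T → 1 ≤ K →
        (∀ p ∈ Z, 1 ≤ p.1 ∧ p.1 ≤ K) → (∀ p ∈ Z, σ ≤ p.2.re) → (∀ p ∈ Z, |p.2.im| < T) →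
        (∀ p ∈ Z, ∀ p' ∈ Z, p.1 = p'.1 → p ≠ p' → 1 ≤ |p.2.im - p'.2.im|) →
        (∀ p ∈ Z, 1 ≤ 9600 * x ^ (1 / 2 - p.2.re) *
            ∫ t : ℝ, ‖heckeL p.1 (1 / 2 + (p.2.im + t) * I)‖ *
              ‖LSeries (moebCoeff p.1 X) (1 / 2 + (p.2.im + t) * I)‖ * ((1 + |t|) ^ 4)⁻¹) →
        (Z.card : ℝ) ≤ C₂ * (A₁ * (1 + c / ((1 - θ) / 2)) ^ c) ^ 2 * x ^ (1 - 2 * σ) *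
            ((K : ℝ) + T + 2) ^ (2 * θ) * (1 + Real.log ((K : ℝ) + T + 2)) ^ (2 * c) *
            ((X + K) * T * (1 + Real.log X) ^ 3) := by
  obtain ⟨C, hC, hsum⟩ := sum_integral_le hMVT
  refine ⟨Real.pi * 9600 ^ 2 * C, by positivity, ?_⟩
  intro A₁ θ c hA₁ hθ hθ1 hPW X x σ T K Z hX hx hT hK hZ1 hZσ hZT hsep hII
  set δ : ℝ := (1 - θ) / 2 with hδ
  have hδ0 : 0 < δ := by rw [hδ]; linarith
  set K' : ℝ := (K : ℝ) + T + 2 with hK'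
  have hK1 : (1 : ℝ) ≤ K := by exact_mod_cast hK
  have hK'1 : 1 ≤ K' := by rw [hK']; linarith
  have hlogK : 0 ≤ Real.log K' := Real.log_nonneg hK'1
  set A₃ : ℝ := A₁ * (1 + c / δ) ^ c * K' ^ θ * (1 + Real.log K') ^ c with hA₃
  have hA₃0 : 0 < A₃ := by positivity
  set B : ℝ := 9600 * x ^ (1 / 2 - σ) * A₃ with hB
  have hB0 : 0 < B := by positivity
  -- each class-II zero: `1 ≤ π B² J_p`
  have hone : ∀ p ∈ Z, (1 : ℝ) ≤ Real.pi * B ^ 2 *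
      ∫ t : ℝ, ‖LSeries (moebCoeff p.1 X) (1 / 2 + (p.2.im + t) * I)‖ ^ 2 * ((1 + |t|) ^ 3)⁻¹ := by
    intro p hp
    have hm : p.1 ≠ 0 := by have := (hZ1 p hp).1; omega
    have hD : ∀ t : ℝ, ‖heckeL p.1 (1 / 2 + (p.2.im + t) * I)‖ ≤ A₃ * (1 + |t|) := fun t ↦
      norm_heckeL_half_le_of_pointwise (by linarith) hθ hθ1 hPW hm (hZ1 p hp).2 (hZT p hp) t
    have hB₀ : (0 : ℝ) < 9600 * x ^ (1 / 2 - p.2.re) := by positivity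
    have h1 := classTwo_single X hA₃0 hB₀ p.2.im hD (hII p hp)
    have hJ0 : 0 ≤ ∫ t : ℝ, ‖LSeries (moebCoeff p.1 X) (1 / 2 + (p.2.im + t) * I)‖ ^ 2 *
        ((1 + |t|) ^ 3)⁻¹ := integral_nonneg fun t ↦ by positivity
    have hxx : x ^ (1 / 2 - p.2.re) ≤ x ^ (1 / 2 - σ) :=
      Real.rpow_le_rpow_of_exponent_le hx (by linarith [hZσ p hp])
    have hBB : 9600 * x ^ (1 / 2 - p.2.re) * A₃ ≤ B :=
      mul_le_mul_of_nonneg_right (mul_le_mul_of_nonneg_left hxx (by norm_num)) hA₃0.le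
    have hsq : (9600 * x ^ (1 / 2 - p.2.re) * A₃) ^ 2 ≤ B ^ 2 := pow_le_pow_left₀ (by positivity) hBB 2
    exact h1.trans (mul_le_mul_of_nonneg_right (mul_le_mul_of_nonneg_left hsq Real.pi_pos.le) hJ0)
  have hS := hsum X T K Z hX hT hK hZ1 hZT hsep
  have e1 : (x ^ (1 / 2 - σ)) ^ 2 = x ^ (1 - 2 * σ) := by
    rw [← Real.rpow_natCast, ← Real.rpow_mul (by linarith)]; norm_num; ring_nf
  have e2 : (K' ^ θ) ^ 2 = K' ^ (2 * θ) := by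
    rw [← Real.rpow_natCast, ← Real.rpow_mul (by linarith)]; norm_num; ring_nf
  have e3 : ((1 + Real.log K') ^ c) ^ 2 = (1 + Real.log K') ^ (2 * c) := by rw [← pow_mul, mul_comm]
  calc (Z.card : ℝ) = ∑ p ∈ Z, (1 : ℝ) := by simp
    _ ≤ ∑ p ∈ Z, Real.pi * B ^ 2 *
          ∫ t : ℝ, ‖LSeries (moebCoeff p.1 X) (1 / 2 + (p.2.im + t) * I)‖ ^ 2 * ((1 + |t|) ^ 3)⁻¹ :=
        sum_le_sum hone
    _ = Real.pi * B ^ 2 * ∑ p ∈ Z,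
          ∫ t : ℝ, ‖LSeries (moebCoeff p.1 X) (1 / 2 + (p.2.im + t) * I)‖ ^ 2 * ((1 + |t|) ^ 3)⁻¹ := by
        rw [mul_sum]
    _ ≤ Real.pi * B ^ 2 * (C * (X + K) * T * (1 + Real.log X) ^ 3) :=
        mul_le_mul_of_nonneg_left hS (by positivity)
    _ = Real.pi * 9600 ^ 2 * C * (A₁ * (1 + c / δ) ^ c) ^ 2 * x ^ (1 - 2 * σ) * K' ^ (2 * θ) *
          (1 + Real.log K') ^ (2 * c) * ((X + K) * T * (1 + Real.log X) ^ 3) := by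
        rw [← e1, ← e2, ← e3, hB, hA₃]; ring

end GaussianHecke

end Literature.NumberTheory.LFunctions
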